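import Literature.MathematicalPhysics.StatisticalMechanics.GridEdgeIsoperimetry
import HarnessLib

/-!
# Extents of edge-isoperimetric minimizers in `ℤ^d`; Mainini–Schmidt's Theorem 1.1 (i) reduced to
# the level-count bound (Mainini–Schmidt 2020, §4, "Proof of Theorem 1.1 (i)")

Topic `Literature/MathematicalPhysics/StatisticalMechanics`; continues `GridEdgeIsoperimetry.lean`
(`EIP^d = cubicleCost d`, nested `EIP^d` solutions and [MS20] Corollary 3.3 in every dimension) and
`EIPSliceRecursion.lean` (sorted profiles, `famStack`, the recursion `EIP^{n+1}(N) = min_f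
{2 max f + Σ EIP^n(f k)}`).  Everything here is PROVED; no named facts are introduced.  Purpose: the
LAST undischarged fact of `EdgeIsoperimetricFluctuations.lean`, `MaininiSchmidt2020_thm11_upper`
([MS20] Theorem 1.1 (i): every `EIP^d` minimizer with `n` points is within
`K_d n^{(d−1+2^{1−d})/d}` of a translate of the Wulff cube `W_n = {1,…,⌊n^{1/d}⌋}^d`), is reduced
here to ONE inequality about OPTIMAL PROFILES of the slicing recursion — i.e. to the content of
[MS20] Lemma 4.7 + Corollary 4.8 — and the two outer layers of the printed proof are done once and
for all dimensions:

* `MaininiSchmidt2020_thm11_upper_of_extent_le` — **the box counting** of [MS20] §4 ("Proof of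
  Theorem 1.1 (i)"): IF every `EIP^d` minimizer `C` (`n = #C`) occupies at most
  `n^{1/d} + K_d n^{2^{1−d}/d}` hyperplanes orthogonal to each axis — equivalently every edge `a_i` of
  its minimal rectangle `R(C)` ([MS20] Definition 4.6) satisfies `a_i ≤ n^{1/d} + K_d n^{2^{1−d}/d}`,
  which is what [MS20] Corollary 4.8 (`a_d − ℓ ≤ 4^{c_d} h_{ℓ,d} + 6` for the LONGEST edge `a_d`,
  `h_{ℓ,d} = ℓ^{2^{1−d}}`, `(ℓ−2)^d ≤ n`) asserts — THEN `MaininiSchmidt2020_thm11_upper`.  Our counting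
  is shorter than the printed one and needs no lower bound on the edges: after the translation
  `a = (min_i x_i − 1)_i` one has `C − a ⊆ R = ∏_i {1,…,a_i}` and `#W_n = ℓ^d ≤ n`, so
  `#((C − a) △ W_n) ≤ #(R ∖ (C−a)) + #(R △ W_n) = 2 #(R ∖ W_n) − (n − ℓ^d) ≤ 2 Σ_i (a_i − ℓ)₊ ∏_{j≠i} a_j
  ≤ 2d (K_d + 1)^d · n^{(d−1)/d} · n^{2^{1−d}/d}` (`card_symmDiff_le_two_mul_card_sdiff`,
  `card_box_sdiff_cube_le`, `sum_box_excess_le`, `rpow_bookkeeping`).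
* `card_image_apply_le_of_levelBound` — **the rearrangement step** ([MS20] Proposition 3.2 as used at
  the start of the proof of Lemma 4.7: "Let `C'` be the decreasing rearrangement of `C` in the
  direction `e_d` … the `j`-level `P_j`"): the number of hyperplanes `{x_s = k}` meeting a minimizer
  `C ⊂ ℤ^d` is the number `T` of levels of its SORTED PROFILE `f` in the direction `e_s`, and that
  profile is OPTIMAL, `2 f(0) + Σ_{k<T} EIP^{d−1}(f k) = EIP^d(n)` (lower bound
  `exists_sortedProfile`, upper bound `eipValue_succ_le_profileCost` over the nested family of
  `GridEdgeIsoperimetry.exists_isNestedMinimizerFamily`).  Hence a bound `T ≤ N^{1/d} + K N^{2^{1−d}/d}`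
  for all optimal sorted profiles gives the extent bound in every direction.
* `MaininiSchmidt2020_thm11_upper_of_levelBound` — the two combined (dimension `1` is unconditional).
* On the way, basic structure of minimizers in every dimension, not in the tree before:
  `eipValue_add_two_le` (**strict subadditivity** `EIP^d(a+b) + 2 ≤ EIP^d(a) + EIP^d(b)`, `a, b ≥ 1`:
  two minimizers placed in contact along one bond), `IsEIPMinimizer.exists_apply_eq` (**minimizers
  have no gaps**: a minimizer meets every hyperplane `{x_i = v}` between two of its points — the
  "we may assume that it contains a point of the form `(i_1,…,i_d)` for any `i_d = 1,…,a_d`" of the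
  proof of [MS20] Lemma 4.7, here a theorem), `IsEIPMinimizer.image_apply_eq_Icc`,
  `IsEIPMinimizer.card_image_apply` (`#{x_i} = max_i − min_i + 1 = a_i`),
  `IsEIPMinimizer.image_sub_subset_box` (the minimal rectangle `R(C) = x_0 + ∏{1,…,a_i}` of
  [MS20] Definition 4.6 with `x_0 = 0` after translation).

## What remains of [MS20] Theorem 1.1 (i) (stated precisely; NOT a named fact, see D-0026)

For every `d ≥ 2` a constant `K_d` with: for every `T` and every non-increasing `f : ℕ → ℕ` with
`f k > 0 ⇔ k < T` and `2 f(0) + Σ_{k<T} EIP^{d−1}(f k) = EIP^d(Σ_{k<T} f k)` (an optimal sorted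
profile, `N := Σ f`), `T ≤ N^{1/d} + K_d N^{2^{1−d}/d}` — the hypothesis of
`MaininiSchmidt2020_thm11_upper_of_levelBound`, verbatim.  By `eipValue_eq_cubicleCost` this is a
statement about the explicit arithmetic function `cubicleCost` of `GridCubicles.lean`; in [MS20] it
is obtained from Lemma 4.7 (every minimizer can be rearranged, keeping `n` and the number of levels,
into the quasi-cube (4.1) — the daisy/defect algorithm of §4) and Corollary 4.8 (cut-and-paste of
the top `p` levels onto a lateral face + Lemma 3.6 in dimension `d − 1`, giving
`p² − 3p ≤ 4^{c_{d−1}} h_{ℓ,d−1}`).  Neither Lemma 4.7 nor Lemma 3.6 / Corollary 4.8 is formalised here.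

## Typing decisions

1. "Extent in direction `e_i`" is `#(C.image fun x => x i)`, the number of occupied hyperplanes; for
   a minimizer it equals the edge `max_i − min_i + 1` of the minimal rectangle
   (`IsEIPMinimizer.card_image_apply`), by the no-gap property.
2. The exponents are written `(1 : ℝ) / d` and `(2 : ℝ) ^ (1 − d) / d` (real powers of `(n : ℝ)`), so
   that `latticeRootFloor d n = ⌊n^{1/d}⌋₊` and `maximalFluctuationExponent d = (d − 1 + 2^{1−d})/d`
   of `EdgeIsoperimetricFluctuations.lean` match literally (`rpow_bookkeeping`:
   `n^{(d−1+2^{1−d})/d} = (n^{1/d})^{d−1} · n^{2^{1−d}/d}`).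
3. The hypotheses of the two reduction theorems are spelled out inline (no auxiliary `Prop`
   definitions), so that a later proof of the level-count bound discharges
   `MaininiSchmidt2020_thm11_upper` by a one-line application.

## References

* [MS20] E. Mainini, B. Schmidt, *Maximal fluctuations around the Wulff shape for edge-isoperimetric
  sets in ℤ^d: a sharp scaling law*, Comm. Math. Phys. 380 (2020) 947–971 = arXiv:2003.01679
  [MaininiSchmidt2020] (store key `paper:arxiv-2003.01679`; §4 = tex chunks p0012–p0016: Definition
  4.6 (minimal rectangle), Lemma 4.7, Corollary 4.8, "Proof of Theorem 1.1 (i)"; Proposition 3.2 =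
  chunk p0009).
-/

noncomputable section

open Finset
open scoped symmDiff

namespace Literature.MathematicalPhysics.StatisticalMechanics

open Literature.Probability.LatticeModels

/-! ### Strict subadditivity of `EIP^d`, monotonicity, and absence of gaps in minimizers -/

section StrictSubadd

variable {d : ℕ}

/-- Boundary pairs of a union are boundary pairs of one of the two parts. [folklore] -/
private theorem boundaryPairs_union_subset' (A B : Finset (Site d)) :
    boundaryPairs (A ∪ B) ⊆ boundaryPairs A ∪ boundaryPairs B := by
  intro u hu
  rw [mem_boundaryPairs] at hu
  rw [mem_union, mem_boundaryPairs, mem_boundaryPairs]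
  rcases mem_union.1 hu.1 with h | h
  · exact Or.inl ⟨h, fun h' => hu.2 (mem_union_left _ h')⟩
  · exact Or.inr ⟨h, fun h' => hu.2 (mem_union_right _ h')⟩

/-- **`EIP^d` is STRICTLY subadditive**: `EIP^d(a + b) + 2 ≤ EIP^d(a) + EIP^d(b)` for `a, b ≥ 1`
(`d ≥ 1`): place a minimizer of `b` points next to a minimizer of `a` points so that two of their
points become neighbours across the hyperplane separating them — the two boundary pairs along that
bond disappear and no new boundary pair is created.  (The source's "bonds connecting two blocks"
count, [MS20] proof of Lemma 3.4; here with one bond.) [cite: MaininiSchmidt2020, Lemma 3.4 (proof: bonds between blocks)] -/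
theorem eipValue_add_two_le (hd : 1 ≤ d) {a b : ℕ} (ha : 1 ≤ a) (hb : 1 ≤ b) :
    eipValue d (a + b) + 2 ≤ eipValue d a + eipValue d b := by
  classical
  obtain ⟨n, rfl⟩ : ∃ n, d = n + 1 := ⟨d - 1, by omega⟩
  obtain ⟨A, hA, hAa⟩ := exists_isEIPMinimizer_card_eq n a
  obtain ⟨B, hB, hBb⟩ := exists_isEIPMinimizer_card_eq n b
  have hAne : A.Nonempty := by rw [← card_pos, hAa]; exact ha
  have hBne : B.Nonempty := by rw [← card_pos, hBb]; exact hb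
  -- the point of `A` with the largest first coordinate, the point of `B` with the smallest
  obtain ⟨xa, hxa, hxamax⟩ := exists_max_image A (fun x : Site (n + 1) => x 0) hAne
  obtain ⟨xb, hxb, hxbmin⟩ := exists_min_image B (fun x : Site (n + 1) => x 0) hBne
  set e : Site (n + 1) := unitStep 0 true with he
  set v : Site (n + 1) := xa + e - xb with hv
  set B' : Finset (Site (n + 1)) := B.image fun y => y + v with hB'
  have he0 : e 0 = 1 := by simp [he, unitStep]
  have hvB' : ∀ y ∈ B, xa 0 + 1 ≤ (y + v) 0 := by
    intro y hy
    have h1 := hxbmin y hy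
    have h2 : (y + v) 0 = y 0 + (xa 0 + 1 - xb 0) := by
      simp [hv, he0]
    rw [h2]; omega
  have hdisj : Disjoint A B' := by
    rw [disjoint_left]
    intro x hxA hxB'
    obtain ⟨y, hy, hyx⟩ := mem_image.1 hxB'
    have h1 := hvB' y hy
    have h2 := hxamax x hxA
    rw [hyx] at h1
    omega
  have hcard : #(A ∪ B') = a + b := by
    rw [card_union_of_disjoint hdisj, hAa, hB', card_image_of_injective _ (add_left_injective v), hBb]
  -- the two boundary pairs that disappear
  have hxae : xa + e = xb + v := by rw [hv]; abel
  have hstep : e + unitStep (0 : Fin (n + 1)) false = 0 := by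
    rw [he, unitStep, unitStep, ← Pi.single_add]; simp
  have hp1A : (xa, (0 : Fin (n + 1)), true) ∈ boundaryPairs A := by
    rw [mem_boundaryPairs]
    refine ⟨hxa, fun h => ?_⟩
    have h1 := hxamax _ h
    have h2 : (xa + unitStep (0 : Fin (n + 1)) true) 0 = xa 0 + 1 := by
      simp [unitStep]
    simp only at h1
    rw [h2] at h1
    omega
  have hxaB' : xa ∉ B' := by
    intro h
    obtain ⟨y, hy, hyx⟩ := mem_image.1 h
    have h1 := hvB' y hy
    rw [hyx] at h1
    omega
  have hp2B' : (xb + v, (0 : Fin (n + 1)), false) ∈ boundaryPairs B' := by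
    rw [mem_boundaryPairs]
    refine ⟨mem_image_of_mem _ hxb, fun h => hxaB' ?_⟩
    have h2 : xb + v + unitStep (0 : Fin (n + 1)) false = xa := by
      rw [← hxae, add_assoc, hstep, add_zero]
    simp only at h
    rwa [h2] at h
  have hp1U : (xa, (0 : Fin (n + 1)), true) ∉ boundaryPairs (A ∪ B') := by
    rw [mem_boundaryPairs, not_and, not_not]
    intro _
    simp only
    rw [show xa + unitStep (0 : Fin (n + 1)) true = xb + v from hxae]
    exact mem_union_right _ (mem_image_of_mem _ hxb)
  have hp2U : (xb + v, (0 : Fin (n + 1)), false) ∉ boundaryPairs (A ∪ B') := by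
    rw [mem_boundaryPairs, not_and, not_not]
    intro _
    have h2 : xb + v + unitStep (0 : Fin (n + 1)) false = xa := by
      rw [← hxae, add_assoc, hstep, add_zero]
    simp only
    rw [h2]
    exact mem_union_left _ hxa
  have hsub : boundaryPairs (A ∪ B') ⊆
      ((boundaryPairs A ∪ boundaryPairs B').erase (xa, 0, true)).erase (xb + v, 0, false) := by
    intro u hu
    rw [mem_erase, mem_erase]
    refine ⟨fun h => hp2U (h ▸ hu), fun h => hp1U (h ▸ hu), boundaryPairs_union_subset' A B' hu⟩
  have hne12 : (xa, (0 : Fin (n + 1)), true) ≠ (xb + v, 0, false) := by simp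
  have hmem2 : (xb + v, (0 : Fin (n + 1)), false) ∈ (boundaryPairs A ∪ boundaryPairs B').erase (xa, 0, true) :=
    mem_erase.2 ⟨hne12.symm, mem_union_right _ hp2B'⟩
  have hmem1 : (xa, (0 : Fin (n + 1)), true) ∈ boundaryPairs A ∪ boundaryPairs B' :=
    mem_union_left _ hp1A
  have hc := card_le_card hsub
  rw [card_erase_of_mem hmem2, card_erase_of_mem hmem1] at hc
  have hcu := card_union_le (boundaryPairs A) (boundaryPairs B')
  have hpos : 2 ≤ #(boundaryPairs A ∪ boundaryPairs B') := by
    have : ({(xa, (0 : Fin (n + 1)), true), (xb + v, 0, false)} : Finset _) ⊆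
        boundaryPairs A ∪ boundaryPairs B' := by
      intro u hu
      rcases mem_insert.1 hu with rfl | hu
      · exact hmem1
      · rw [mem_singleton] at hu; rw [hu]; exact mem_union_right _ hp2B'
    have h2 := card_le_card this
    rwa [card_pair hne12] at h2
  have hval := eipValue_le (A ∪ B')
  rw [hcard] at hval
  have hBB' : #(boundaryPairs B') = eipValue (n + 1) b := by
    rw [hB', card_boundaryPairs_image_add_right, hB.card_boundaryPairs_eq hBb]
  have hAA : #(boundaryPairs A) = eipValue (n + 1) a := hA.card_boundaryPairs_eq hAa
  omega

end StrictSubadd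


section NoGaps

variable {d : ℕ}

/-- **Minimizers have no gaps**: if an `EIP^d` minimizer `C` has points on both sides of the
hyperplane `{x_i = v}` (weakly), then it meets that hyperplane.  Otherwise `C` splits into two parts
at `ℓ¹`-distance `≥ 2`, whose perimeters add up, contradicting the strict subadditivity
`eipValue_add_two_le`.  ([MS20] proof of Lemma 4.7: "Since `C` is an `EIP^d` minimizer, we may assume
that it contains a point of the form `(i_1, …, i_d)` for any `i_d = 1, …, a_d`.")
[cite: MaininiSchmidt2020, Lemma 4.7 (proof, first sentence)] -/
theorem IsEIPMinimizer.exists_apply_eq {C : Finset (Site d)} (hC : IsEIPMinimizer C) (i : Fin d)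
    {v : ℤ} (hlo : ∃ x ∈ C, x i ≤ v) (hhi : ∃ y ∈ C, v ≤ y i) : ∃ z ∈ C, z i = v := by
  classical
  by_contra hne
  push Not at hne
  have hd : 1 ≤ d := by
    rcases Nat.eq_zero_or_pos d with h | h
    · subst h; exact i.elim0
    · exact h
  set L := C.filter fun x => x i < v with hL
  set U := C.filter fun x => v < x i with hU
  have hLU : C = L ∪ U := by
    ext x
    rw [mem_union, hL, hU, mem_filter, mem_filter]
    constructor
    · intro hx
      rcases lt_trichotomy (x i) v with h | h | h
      · exact Or.inl ⟨hx, h⟩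
      · exact absurd h (hne x hx)
      · exact Or.inr ⟨hx, h⟩
    · rintro (⟨hx, _⟩ | ⟨hx, _⟩) <;> exact hx
  have hdisj : Disjoint L U := by
    rw [disjoint_left]
    intro x hxL hxU
    have h1 := (mem_filter.1 hxL).2
    have h2 := (mem_filter.1 hxU).2
    omega
  have hLne : 1 ≤ #L := by
    obtain ⟨x, hx, hxv⟩ := hlo
    exact card_pos.2 ⟨x, mem_filter.2 ⟨hx, lt_of_le_of_ne hxv (hne x hx)⟩⟩
  have hUne : 1 ≤ #U := by
    obtain ⟨y, hy, hyv⟩ := hhi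
    exact card_pos.2 ⟨y, mem_filter.2 ⟨hy, lt_of_le_of_ne hyv (fun h => hne y hy h.symm)⟩⟩
  -- a lattice step changes the `i`-th coordinate by at most one
  have hstep : ∀ (x : Site d) (j : Fin d) (b : Bool),
      (x + unitStep j b) i ≤ x i + 1 ∧ x i ≤ (x + unitStep j b) i + 1 := by
    intro x j b
    simp only [Pi.add_apply, unitStep, Pi.single_apply]
    split_ifs <;> constructor <;> omega
  -- the boundary pairs of `C` are exactly those of `L` and those of `U`
  have hbp : boundaryPairs C = boundaryPairs L ∪ boundaryPairs U := by
    ext ⟨x, j, b⟩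
    rw [mem_union, mem_boundaryPairs, mem_boundaryPairs, mem_boundaryPairs]
    simp only
    constructor
    · rintro ⟨hx, hx'⟩
      rw [hLU, mem_union] at hx
      rcases hx with hx | hx
      · exact Or.inl ⟨hx, fun h => hx' (hLU ▸ mem_union_left _ h)⟩
      · exact Or.inr ⟨hx, fun h => hx' (hLU ▸ mem_union_right _ h)⟩
    · rintro (⟨hx, hx'⟩ | ⟨hx, hx'⟩)
      · refine ⟨hLU ▸ mem_union_left _ hx, fun h => ?_⟩
        rw [hLU, mem_union] at h
        rcases h with h | h
        · exact hx' h
        · have h1 := (mem_filter.1 hx).2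
          have h2 := (mem_filter.1 h).2
          have h3 := (hstep x j b).1
          omega
      · refine ⟨hLU ▸ mem_union_right _ hx, fun h => ?_⟩
        rw [hLU, mem_union] at h
        rcases h with h | h
        · have h1 := (mem_filter.1 hx).2
          have h2 := (mem_filter.1 h).2
          have h3 := (hstep x j b).2
          omega
        · exact hx' h
  have hbpdisj : Disjoint (boundaryPairs L) (boundaryPairs U) := by
    rw [disjoint_left]
    rintro ⟨x, j, b⟩ h1 h2
    exact disjoint_left.1 hdisj (mem_boundaryPairs.1 h1).1 (mem_boundaryPairs.1 h2).1
  have hcardC : #C = #L + #U := by rw [hLU, card_union_of_disjoint hdisj]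
  have h1 : #(boundaryPairs C) = #(boundaryPairs L) + #(boundaryPairs U) := by
    rw [hbp, card_union_of_disjoint hbpdisj]
  have h2 := eipValue_le L
  have h3 := eipValue_le U
  have h4 := eipValue_add_two_le hd hLne hUne
  have h5 : #(boundaryPairs C) = eipValue d #C := hC.card_boundaryPairs_eq rfl
  rw [hcardC] at h5
  omega

/-- The set of values of the `i`-th coordinate on a non-empty `EIP^d` minimizer is the full integer
interval between its extreme values. [cite: MaininiSchmidt2020, Lemma 4.7 (proof, first sentence) and Definition 4.6 (minimal rectangle)] -/
theorem IsEIPMinimizer.image_apply_eq_Icc {C : Finset (Site d)} (hC : IsEIPMinimizer C)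
    (hne : C.Nonempty) (i : Fin d) :
    C.image (fun x => x i) =
      Icc ((C.image fun x => x i).min' (hne.image _)) ((C.image fun x => x i).max' (hne.image _)) := by
  classical
  ext v
  rw [mem_Icc]
  constructor
  · intro hv
    exact ⟨min'_le _ _ hv, le_max' _ _ hv⟩
  · rintro ⟨h1, h2⟩
    obtain ⟨x, hx, hxv⟩ := mem_image.1 (min'_mem (C.image fun x => x i) (hne.image _))
    obtain ⟨y, hy, hyv⟩ := mem_image.1 (max'_mem (C.image fun x => x i) (hne.image _))
    obtain ⟨z, hz, hzv⟩ := hC.exists_apply_eq i (v := v) ⟨x, hx, by rw [hxv]; exact h1⟩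
      ⟨y, hy, by rw [hyv]; exact h2⟩
    exact mem_image.2 ⟨z, hz, hzv⟩

/-- For a non-empty minimizer, `#{x_i : x ∈ C} = max_i − min_i + 1`: the number of occupied
hyperplanes orthogonal to `e_i` is the `i`-th edge `a_i` of the minimal rectangle `R(C)`.
[cite: MaininiSchmidt2020, Definition 4.6 (minimal rectangle)] -/
theorem IsEIPMinimizer.card_image_apply {C : Finset (Site d)} (hC : IsEIPMinimizer C)
    (hne : C.Nonempty) (i : Fin d) :
    (#(C.image fun x => x i) : ℤ) =
      (C.image fun x => x i).max' (hne.image _) - (C.image fun x => x i).min' (hne.image _) + 1 := by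
  have h := congrArg Finset.card (hC.image_apply_eq_Icc hne i)
  rw [Int.card_Icc] at h
  have hle : (C.image fun x => x i).min' (hne.image _) ≤ (C.image fun x => x i).max' (hne.image _) :=
    min'_le_max' _ _
  rw [h]
  omega

/-- **The minimal rectangle**: after the translation by `a = (min_i − 1)_i`, a non-empty minimizer
lies in the box `∏_i {1, …, a_i}` with `a_i = #{x_i : x ∈ C}` ([MS20] Definition 4.6, "assume wlog
that `x_0 = 0`"). [cite: MaininiSchmidt2020, Definition 4.6 and Lemma 4.7] -/
theorem IsEIPMinimizer.image_sub_subset_box {C : Finset (Site d)} (hC : IsEIPMinimizer C)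
    (hne : C.Nonempty) :
    (C.image fun x => x - fun i => (C.image fun x => x i).min' (hne.image _) - 1) ⊆
      Fintype.piFinset fun i => Icc (1 : ℤ) (#(C.image fun x => x i)) := by
  classical
  intro y hy
  obtain ⟨x, hx, rfl⟩ := mem_image.1 hy
  rw [Fintype.mem_piFinset]
  intro i
  rw [mem_Icc, hC.card_image_apply hne i]
  simp only [Pi.sub_apply]
  have hxi : x i ∈ C.image fun x => x i := mem_image_of_mem (fun x => x i) hx
  have h1 : (C.image fun x => x i).min' (hne.image _) ≤ x i := min'_le _ _ hxi
  have h2 : x i ≤ (C.image fun x => x i).max' (hne.image _) := le_max' _ _ hxi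
  constructor <;> omega

end NoGaps


/-! ### Mainini–Schmidt's Theorem 1.1 (i) from the extent bound (the box counting of [MS20] §4) -/

section Assembly

variable {d : ℕ}

/-- Triangle inequality for the cardinality of symmetric differences. [folklore] -/
private theorem card_symmDiff_le_card_symmDiff_add (X Y Z : Finset (Site d)) :
    #(X ∆ Z) ≤ #(X ∆ Y) + #(Y ∆ Z) :=
  (card_le_card (symmDiff_triangle X Y Z)).trans (card_union_le _ _)

/-- For `C ⊆ R` and `#W ≤ #C`: `#(C △ W) ≤ 2·#(R ∖ W)` — the symmetric difference with the Wulff cube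
is controlled by the part of the minimal rectangle outside the cube ([MS20] §4, proof of
Theorem 1.1 (i): "`#R(C) △ {1,…,ℓ}^d = O(h ℓ^{d−1})` … so by the triangle inequality").
[cite: MaininiSchmidt2020, Theorem 1.1 (i) (proof, last paragraph)] -/
theorem card_symmDiff_le_two_mul_card_sdiff {C R W : Finset (Site d)} (hCR : C ⊆ R)
    (hW : #W ≤ #C) : #(C ∆ W) ≤ 2 * #(R \ W) := by
  have h1 := card_symmDiff_le_card_symmDiff_add C R W
  have h2 : #(C ∆ R) = #R - #C := by
    rw [symmDiff_of_le hCR, card_sdiff_of_subset hCR]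
  have h3 : #(R ∆ W) = #(R \ W) + #(W \ R) := by
    rw [symmDiff_def, sup_eq_union, card_union_of_disjoint disjoint_sdiff_sdiff]
  have h4 := card_sdiff_add_card_inter R W
  have h5 := card_sdiff_add_card_inter W R
  rw [inter_comm] at h5
  have h6 := card_le_card hCR
  omega

/-- The part of the box `∏_j {1,…,A_j}` outside the cube `{1,…,ℓ}^d` is covered by the `d` slabs
`{x : x_i > ℓ}`, each inside a box with `i`-th edge `{ℓ+1,…,A_i}`. [cite: MaininiSchmidt2020, Theorem 1.1 (i) (proof: #R(C) △ {1,…,ℓ}^d ≤ (ℓ + 4^{c_d}h)^d − (ℓ − 2d4^{c_d}h)^d)] -/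
theorem card_box_sdiff_cube_le (A : Fin d → ℕ) (ℓ : ℕ) :
    #((Fintype.piFinset fun j => Icc (1 : ℤ) (A j)) \ Fintype.piFinset fun _ => Icc (1 : ℤ) ℓ) ≤
      ∑ i, (((A i : ℤ) - ℓ).toNat * ∏ j ∈ univ.erase i, A j) := by
  classical
  set R := Fintype.piFinset fun j => Icc (1 : ℤ) (A j) with hR
  set t : Fin d → Fin d → Finset ℤ := fun i j =>
    if j = i then Icc ((ℓ : ℤ) + 1) (A i) else Icc (1 : ℤ) (A j) with ht
  have hsub : R \ (Fintype.piFinset fun _ => Icc (1 : ℤ) ℓ) ⊆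
      univ.biUnion fun i => Fintype.piFinset (t i) := by
    intro x hx
    rw [mem_sdiff, hR, Fintype.mem_piFinset, Fintype.mem_piFinset, not_forall] at hx
    obtain ⟨hxR, i, hi⟩ := hx
    rw [mem_biUnion]
    refine ⟨i, mem_univ _, Fintype.mem_piFinset.2 fun j => ?_⟩
    simp only [ht]
    split_ifs with hji
    · subst hji
      have h1 := mem_Icc.1 (hxR j)
      rw [mem_Icc, not_and_or, not_le, not_le] at hi
      rw [mem_Icc]
      omega
    · exact hxR j
  refine (card_le_card hsub).trans (card_biUnion_le.trans (sum_le_sum fun i _ => ?_))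
  rw [Fintype.card_piFinset, ← Finset.mul_prod_erase univ (fun j => #(t i j)) (mem_univ i)]
  have h1 : #(t i i) = ((A i : ℤ) - ℓ).toNat := by
    simp only [ht, if_true, Int.card_Icc]
    congr 1; ring
  have h2 : ∀ j ∈ univ.erase i, #(t i j) = A j := by
    intro j hj
    simp only [ht, if_neg (ne_of_mem_erase hj), Int.card_Icc]
    simp
  rw [h1, prod_congr rfl h2]

/-- Real-number bookkeeping for `n ≥ 1`, `d ≥ 1`: with `λ = n^{1/d}`, `μ = n^{2^{1−d}/d}` one has
`λ^d = n`, `1 ≤ μ ≤ λ` and `n^{(d−1+2^{1−d})/d} = λ^{d−1} μ`. [cite: MaininiSchmidt2020, Theorem 1.1 (the exponent (d−1+2^{1−d})/d)] -/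
theorem rpow_bookkeeping (hd : 1 ≤ d) {n : ℕ} (hn : 1 ≤ n) :
    ((n : ℝ) ^ ((1 : ℝ) / d)) ^ d = n ∧
    1 ≤ (n : ℝ) ^ ((2 : ℝ) ^ (1 - (d : ℝ)) / d) ∧
    (n : ℝ) ^ ((2 : ℝ) ^ (1 - (d : ℝ)) / d) ≤ (n : ℝ) ^ ((1 : ℝ) / d) ∧
    (n : ℝ) ^ maximalFluctuationExponent d =
      ((n : ℝ) ^ ((1 : ℝ) / d)) ^ (d - 1) * (n : ℝ) ^ ((2 : ℝ) ^ (1 - (d : ℝ)) / d) := by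
  have hn0 : (0 : ℝ) < n := by exact_mod_cast hn
  have hn1 : (1 : ℝ) ≤ n := by exact_mod_cast hn
  have hd0 : (d : ℝ) ≠ 0 := by exact_mod_cast (show d ≠ 0 by omega)
  have hdpos : (0 : ℝ) < d := by exact_mod_cast (show 0 < d by omega)
  have h2 : (2 : ℝ) ^ (1 - (d : ℝ)) ≤ 1 :=
    Real.rpow_le_one_of_one_le_of_nonpos (by norm_num)
      (by have : (1 : ℝ) ≤ d := by exact_mod_cast hd
          linarith)
  have h2pos : (0 : ℝ) < (2 : ℝ) ^ (1 - (d : ℝ)) := Real.rpow_pos_of_pos (by norm_num) _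
  refine ⟨?_, ?_, ?_, ?_⟩
  · rw [← Real.rpow_natCast, ← Real.rpow_mul hn0.le, one_div_mul_cancel hd0, Real.rpow_one]
  · exact Real.one_le_rpow hn1 (div_nonneg h2pos.le hdpos.le)
  · exact Real.rpow_le_rpow_of_exponent_le hn1 (div_le_div_of_nonneg_right h2 hdpos.le)
  · rw [maximalFluctuationExponent, ← Real.rpow_natCast, ← Real.rpow_mul hn0.le,
      ← Real.rpow_add hn0]
    congr 1
    rw [Nat.cast_sub hd, Nat.cast_one]
    field_simp

/-- The real-number step of the box counting: if every edge satisfies `a_i ≤ λ + K'μ` with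
`ℓ ≤ λ < ℓ + 1`, `1 ≤ μ ≤ λ`, then `Σ_i (a_i − ℓ)₊ ∏_{j≠i} a_j ≤ d (K'+1)^d λ^{d−1} μ`.
[cite: MaininiSchmidt2020, Theorem 1.1 (i) (proof: #R(C) △ {1,…,ℓ}^d = O(h_{ℓ,d} ℓ^{d−1}))] -/
theorem sum_box_excess_le (hd : 1 ≤ d) {K' lam mu : ℝ} (hK' : 0 ≤ K') (hmu1 : 1 ≤ mu)
    (hmulam : mu ≤ lam) {ℓ : ℕ} (hlamℓ : lam < ℓ + 1) (A : Fin d → ℕ)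
    (hAi : ∀ i, (A i : ℝ) ≤ lam + K' * mu) :
    ((∑ i, (((A i : ℤ) - ℓ).toNat * ∏ j ∈ univ.erase i, A j) : ℕ) : ℝ) ≤
      d * (K' + 1) ^ d * (lam ^ (d - 1) * mu) := by
  have hAi' : ∀ i, (A i : ℝ) ≤ (K' + 1) * lam := by
    intro i
    have := hAi i
    nlinarith [hmulam, hK', hmu1]
  have htoNat : ∀ i, ((((A i : ℤ) - ℓ).toNat : ℕ) : ℝ) ≤ (K' + 1) * mu := by
    intro i
    have h0 : (0 : ℝ) ≤ (K' + 1) * mu := by nlinarith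
    by_cases h : (A i : ℤ) ≤ ℓ
    · rw [Int.toNat_of_nonpos (by omega)]
      simpa using h0
    · have h2 : ((((A i : ℤ) - ℓ).toNat : ℕ) : ℤ) = (A i : ℤ) - ℓ := Int.toNat_of_nonneg (by omega)
      have h1 : ((((A i : ℤ) - ℓ).toNat : ℕ) : ℝ) = (A i : ℝ) - ℓ := by exact_mod_cast h2
      rw [h1]
      have := hAi i
      nlinarith [hmu1, hK']
  have hprod : ∀ i, ((∏ j ∈ univ.erase i, A j : ℕ) : ℝ) ≤ ((K' + 1) * lam) ^ (d - 1) := by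
    intro i
    push_cast
    have h := Finset.prod_le_prod (s := univ.erase i) (f := fun j => (A j : ℝ))
      (g := fun _ => (K' + 1) * lam) (fun j _ => by positivity) (fun j _ => hAi' j)
    rwa [prod_const, card_erase_of_mem (mem_univ i), card_univ, Fintype.card_fin] at h
  have hmu0 : 0 ≤ mu := by linarith
  have hsum := Finset.sum_le_sum (s := (univ : Finset (Fin d)))
    (f := fun i => (((((A i : ℤ) - ℓ).toNat : ℕ) : ℝ) * ((∏ j ∈ univ.erase i, A j : ℕ) : ℝ)))
    (g := fun _ => (K' + 1) * mu * ((K' + 1) * lam) ^ (d - 1))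
    (fun i _ => mul_le_mul (htoNat i) (hprod i) (by positivity) (by positivity))
  rw [sum_const, card_univ, Fintype.card_fin, nsmul_eq_mul] at hsum
  have h2 : (K' + 1) * mu * ((K' + 1) * lam) ^ (d - 1) = (K' + 1) ^ d * (lam ^ (d - 1) * mu) := by
    obtain ⟨e, he⟩ : ∃ e, d = e + 1 := ⟨d - 1, by omega⟩
    subst he
    rw [Nat.add_sub_cancel, mul_pow, pow_succ]
    ring
  rw [h2, ← mul_assoc] at hsum
  refine le_trans (le_of_eq ?_) hsum
  push_cast
  rfl

/-- **[MS20] Theorem 1.1 (i) from the extent bound.**  Suppose that for every `d ≥ 1` there is `K_d`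
such that every `EIP^d` minimizer `C` occupies, in every coordinate direction, at most
`n^{1/d} + K_d n^{2^{1−d}/d}` hyperplanes (`n = #C`) — i.e. every edge of the minimal rectangle
`R(C)` is `≤ n^{1/d} + K_d n^{2^{1−d}/d}`, the content of [MS20] Lemma 4.7 + Corollary 4.8
(`a_d − ℓ ≤ 4^{c_d} h_{ℓ,d} + 6`).  Then `#((C − a) △ W_n) ≤ K'_d n^{(d−1+2^{1−d})/d}` for a suitable
translation `a`, i.e. the vendored fact `MaininiSchmidt2020_thm11_upper` holds.  Box counting:
`C − a ⊆ R = ∏{1,…,a_i}`, `#W_n = ℓ^d ≤ n`, hence `#((C−a) △ W_n) ≤ 2 #(R ∖ W_n)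
≤ 2 Σ_i (a_i − ℓ)₊ ∏_{j≠i} a_j ≤ 2d (K+1)^d n^{(d−1+2^{1−d})/d}` (no lower bound on the `a_i` is
needed in this form of the argument). [cite: MaininiSchmidt2020, Theorem 1.1 (i) (proof, §4 last page)] -/
theorem MaininiSchmidt2020_thm11_upper_of_extent_le
    (hEXT : ∀ d : ℕ, 1 ≤ d → ∃ K : ℝ, ∀ C : Finset (Site d), IsEIPMinimizer C → ∀ i : Fin d,
      (#(C.image fun x => x i) : ℝ) ≤
        (#C : ℝ) ^ ((1 : ℝ) / d) + K * (#C : ℝ) ^ ((2 : ℝ) ^ (1 - (d : ℝ)) / d)) :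
    MaininiSchmidt2020_thm11_upper := by
  classical
  intro d hd
  obtain ⟨K, hK⟩ := hEXT d hd
  set K' : ℝ := max K 0 with hK'
  have hK'0 : 0 ≤ K' := le_max_right _ _
  have hKK' : K ≤ K' := le_max_left _ _
  refine ⟨2 * d * (K' + 1) ^ d + 1, by positivity, fun n C hC hCn => ?_⟩
  rcases C.eq_empty_or_nonempty with rfl | hne
  · refine ⟨0, ?_⟩
    have hn : n = 0 := by rw [← hCn, card_empty]
    subst hn
    have hW : wulffCube d 0 = ∅ := by
      rw [← card_eq_zero, card_wulffCube, latticeRootFloor, Nat.cast_zero,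
        Real.zero_rpow (by positivity), Nat.floor_zero, zero_pow (by omega)]
    rw [hW, image_empty]
    simp only [symmDiff_self, Finset.bot_eq_empty, card_empty, Nat.cast_zero]
    positivity
  have hn1 : 1 ≤ n := by rw [← hCn]; exact card_pos.2 hne
  -- the translation and the minimal rectangle
  set a : Site d := fun i => (C.image fun x => x i).min' (hne.image _) - 1 with ha
  refine ⟨a, ?_⟩
  set A : Fin d → ℕ := fun i => #(C.image fun x => x i) with hA
  set R : Finset (Site d) := Fintype.piFinset fun j => Icc (1 : ℤ) (A j) with hR
  have hCR : (C.image fun x => x - a) ⊆ R := hC.image_sub_subset_box hne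
  set ℓ := latticeRootFloor d n with hℓ
  have hWℓ : wulffCube d n = Fintype.piFinset fun _ => Icc (1 : ℤ) ℓ := rfl
  have hcardC' : #(C.image fun x => x - a) = n := by
    rw [card_image_of_injective _ (sub_left_injective), hCn]
  have hWC : #(wulffCube d n) ≤ #(C.image fun x => x - a) := by
    rw [card_wulffCube, hcardC']
    exact latticeRootFloor_pow_le hd n
  -- the combinatorial bound
  have hcomb : #((C.image fun x => x - a) ∆ wulffCube d n) ≤
      2 * ∑ i, (((A i : ℤ) - ℓ).toNat * ∏ j ∈ univ.erase i, A j) :=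
    (card_symmDiff_le_two_mul_card_sdiff hCR hWC).trans
      (Nat.mul_le_mul_left 2 (by rw [hWℓ]; exact card_box_sdiff_cube_le A ℓ))
  -- real bookkeeping
  obtain ⟨-, hmu1, hmulam, hgamma⟩ := rpow_bookkeeping hd hn1
  set lam : ℝ := (n : ℝ) ^ ((1 : ℝ) / d) with hlamdef
  set mu : ℝ := (n : ℝ) ^ ((2 : ℝ) ^ (1 - (d : ℝ)) / d) with hmudef
  have hlamℓ : lam < ℓ + 1 := Nat.lt_floor_add_one lam
  have hAi : ∀ i, (A i : ℝ) ≤ lam + K' * mu := by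
    intro i
    have h := hK C hC i
    rw [hCn] at h
    have : K * mu ≤ K' * mu := mul_le_mul_of_nonneg_right hKK' (by positivity)
    simp only [hA]
    linarith
  -- assemble
  have hsum := sum_box_excess_le hd hK'0 hmu1 hmulam hlamℓ A hAi
  have h1 : (#((C.image fun x => x - a) ∆ wulffCube d n) : ℝ) ≤
      2 * ((∑ i, (((A i : ℤ) - ℓ).toNat * ∏ j ∈ univ.erase i, A j) : ℕ) : ℝ) := by
    exact_mod_cast hcomb
  have hfinal : (#((C.image fun x => x - a) ∆ wulffCube d n) : ℝ) ≤
      2 * d * (K' + 1) ^ d * (lam ^ (d - 1) * mu) := by nlinarith [hsum, h1]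
  rw [hgamma]
  have hpos : 0 ≤ lam ^ (d - 1) * mu := by positivity
  nlinarith [hfinal, hpos]

end Assembly


/-! ### The extent bound from the level-count bound for optimal profiles ([MS20] Prop. 3.2 rearrangement) -/

section Levels

variable {d : ℕ}

/-- The first coordinates of the copy of `C` with the axis `e_s` moved to the front are the `s`-th
coordinates of `C`. [cite: MaininiSchmidt2020, Definition 2.11 and Proposition 3.2] -/
theorem firstCoords_image_relabel_cycleRange_symm {n : ℕ} (s : Fin (n + 1))
    (C : Finset (Site (n + 1))) :
    firstCoords (C.image (relabel (Fin.cycleRange s).symm)) = C.image fun x => x s := by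
  classical
  unfold firstCoords
  rw [image_image]
  refine image_congr fun x _ => ?_
  simp [Function.comp, relabel_cycleRange_symm_eq_cons]

/-- **The extent bound from the level-count bound.**  Let `d ≥ 2`.  Suppose every OPTIMAL sorted
profile over `ℤ^{d−1}` — a non-increasing `f`, positive exactly on `[0, T)`, whose cost
`2 f(0) + Σ_{k<T} EIP^{d−1}(f k)` equals `EIP^d(Σ f)`, i.e. the level sizes of a sorted stack of
nested `EIP^{d−1}` minimizers which is an `EIP^d` minimizer ([MS20] Proposition 3.2) — has at most
`N^{1/d} + K N^{2^{1−d}/d}` levels (`N = Σ f`).  Then every `EIP^d` minimizer `C` occupies, in every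
direction `e_s`, at most `n^{1/d} + K n^{2^{1−d}/d}` hyperplanes (`n = #C`): move `e_s` to the front
(`relabel`), sort the section cardinalities (`exists_sortedProfile`); by [MS20] Proposition 3.2 the
sorted profile of a minimizer is optimal, and it has exactly `#{x_s : x ∈ C}` levels.
[cite: MaininiSchmidt2020, Proposition 3.2 and Lemma 4.7 (the levels P_j of C')] -/
theorem card_image_apply_le_of_levelBound (hd : 2 ≤ d) {K : ℝ}
    (hLEV : ∀ (T : ℕ) (f : ℕ → ℕ), Antitone f → (∀ k, T ≤ k → f k = 0) → (∀ k, k < T → 0 < f k) →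
      profileCost (d - 1) f T = eipValue d (∑ k ∈ range T, f k) →
      (T : ℝ) ≤ ((∑ k ∈ range T, f k : ℕ) : ℝ) ^ ((1 : ℝ) / d) +
        K * ((∑ k ∈ range T, f k : ℕ) : ℝ) ^ ((2 : ℝ) ^ (1 - (d : ℝ)) / d))
    {C : Finset (Site d)} (hC : IsEIPMinimizer C) (s : Fin d) :
    (#(C.image fun x => x s) : ℝ) ≤
      (#C : ℝ) ^ ((1 : ℝ) / d) + K * (#C : ℝ) ^ ((2 : ℝ) ^ (1 - (d : ℝ)) / d) := by
  classical
  obtain ⟨n, rfl⟩ : ∃ n, d = n + 1 := ⟨d - 1, by omega⟩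
  have hn : 1 ≤ n := by omega
  simp only [Nat.add_sub_cancel] at hLEV
  set C' : Finset (Site (n + 1)) := C.image (relabel (Fin.cycleRange s).symm) with hC'def
  have hC' : IsEIPMinimizer C' := hC.image_relabel _
  have hcardC' : #C' = #C := card_image_of_injective _ (relabel_injective _)
  have hfc : firstCoords C' = C.image fun x => x s := firstCoords_image_relabel_cycleRange_symm s C
  obtain ⟨T, f, hT, hf, hsupp, hpos, hsum, -, -, hcost⟩ := exists_sortedProfile C'
  obtain ⟨D, hD⟩ := exists_isNestedMinimizerFamily (d := n) hn
  have hmin : #(boundaryPairs C') = eipValue (n + 1) (∑ k ∈ range T, f k) := by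
    rw [hsum]; exact hC'.card_boundaryPairs_eq rfl
  have h1 : profileCost n f T ≤ eipValue (n + 1) (∑ k ∈ range T, f k) := by
    rw [profileCost_def, ← hmin]; exact hcost
  have h2 : eipValue (n + 1) (∑ k ∈ range T, f k) ≤ profileCost n f T :=
    eipValue_succ_le_profileCost hD hf (hsupp T le_rfl)
  have h := hLEV T f hf hsupp hpos (le_antisymm h1 h2)
  rw [hsum, hcardC', hT, hfc] at h
  exact h

/-- **[MS20] Theorem 1.1 (i) REDUCED to the level-count bound for optimal profiles.**  If for every
`d ≥ 2` there is `K_d` such that every optimal sorted profile over `ℤ^{d−1}` (as in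
`card_image_apply_le_of_levelBound`) with `N` points has at most `N^{1/d} + K_d N^{2^{1−d}/d}` levels —
the content of [MS20] Lemma 4.7 + Corollary 4.8 (`a_d − ℓ ≤ 4^{c_d} h_{ℓ,d} + 6` for the number
`a_d` of levels of a minimizer, `h_{ℓ,d} = ℓ^{2^{1−d}}`) — then the vendored fact
`MaininiSchmidt2020_thm11_upper` ([MS20] Theorem 1.1 (i), every `d ≥ 1`) holds.  Dimension `1` needs
no hypothesis (`#{x_0} ≤ #C = n^{1/1}`).  What remains of [MS20] Theorem 1.1 (i) after this file is
therefore a statement about the arithmetic function `EIP^d = cubicleCost d`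
(`GridEdgeIsoperimetry.eipValue_eq_cubicleCost`) and its optimal profiles only.
[cite: MaininiSchmidt2020, Theorem 1.1 (i), Lemma 4.7, Corollary 4.8] -/
theorem MaininiSchmidt2020_thm11_upper_of_levelBound
    (hLEV : ∀ d : ℕ, 2 ≤ d → ∃ K : ℝ,
      ∀ (T : ℕ) (f : ℕ → ℕ), Antitone f → (∀ k, T ≤ k → f k = 0) → (∀ k, k < T → 0 < f k) →
        profileCost (d - 1) f T = eipValue d (∑ k ∈ range T, f k) →
        (T : ℝ) ≤ ((∑ k ∈ range T, f k : ℕ) : ℝ) ^ ((1 : ℝ) / d) +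
          K * ((∑ k ∈ range T, f k : ℕ) : ℝ) ^ ((2 : ℝ) ^ (1 - (d : ℝ)) / d)) :
    MaininiSchmidt2020_thm11_upper := by
  classical
  refine MaininiSchmidt2020_thm11_upper_of_extent_le fun d hd => ?_
  rcases (show d = 1 ∨ 2 ≤ d by omega) with rfl | hd2
  · refine ⟨0, fun C _ i => ?_⟩
    rw [zero_mul, add_zero, Nat.cast_one, div_one, Real.rpow_one]
    exact_mod_cast card_image_le
  · obtain ⟨K, hK⟩ := hLEV d hd2
    exact ⟨K, fun C hC i => card_image_apply_le_of_levelBound hd2 hK hC i⟩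

end Levels

end Literature.MathematicalPhysics.StatisticalMechanics
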